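import Mathlib
import Literature.NumberTheory.LFunctions.Zhang2022.Section17Step17u025
import Literature.NumberTheory.LFunctions.Zhang2022.Section17U023Chi
import Literature.NumberTheory.LFunctions.Zhang2022.TypedSection17RelE
import Literature.NumberTheory.LFunctions.Zhang2022.TypedSection15E
import Literature.NumberTheory.LFunctions.Zhang2022.SkeletonAlpha1
import HarnessLib

/-!
# Zhang (2022) §17 p. 98, the inputs of u024/u026 at the PARAMETER `e″ = e1pp` (RT-05) and at the
# PRINTED rate `α₁` of Lemma 15.1: u023-χ from `Lemma151ChiRE e1pp`, and u025 at the parameter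
# (`Step17_u025E e1pp`, a theorem for every `e1pp`) — theorems only

Topic `Literature/NumberTheory/LFunctions/Zhang2022` (Landau–Siegel audit tree; verdict-neutral).
Y. Zhang, *Discrete mean estimates and the Landau–Siegel zero*, arXiv:2211.02515v1 (2022)
[Zhang2022LandauSiegel] — **an unrefereed manuscript under adjudication**; the displays are CLAIM nodes
of `Typed.Section17` / `TypedSection17RelE`, stated not asserted; nothing here bears on Theorems 1–2 of
the source or on Landau–Siegel zeros. §17 p. 98 (tex L4825–L4844; DAG `Z22:§17.u023`, `Z22:§17.u024`,
`Z22:§17.u025`).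

WHY THIS FILE (ZHANG-L lane, RE-TYPE RT-05 = zl-lead R-22/R-28, WP16-PLAN W16-S5a follow-up (1),
referee word zl-w16-ref-2 2026-08-27T01:19Z). The skeleton binder of record for the leaf (17.9) is the
E-twin `Typed.Section17.Eq17_9RelE e1ppD c′` (`SkeletonWholeDAGv27`): the `𝔢₁`-chain of §17 is carried
at the PARAMETER `e1pp` (value of `e″₁ⱼ`) and instantiated at the DERIVED `e1ppD` (App. B's own
computation, `AppendixB.e1ppD_eq`), not at the value `e1ppj` stated in Lemma 15.1/(B.3) (rows
G-L4t10-1 / G-num2-1 / D-G-num2-1; kernel `Numerics.not_StepB_u015c`). The tree's χ-reading chain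
`Phi3Eval.eq17_9Rel_of_chiNodes` (`Section17Eq179ChiEdges`, zl-w16-p3) is the `e1ppj` instance and takes
Lemma 15.1 at the rate `α𝓛` (`Skeleton.Lemma151Chi`), whereas the form WP15 actually delivers from the
Appendix-B legs is `Skeleton.Lemma151ChiRE e1pp c′` (`TypedSection15E`; `Section15EChain.
lemma151ChiRE_of_evals`) at the PRINTED rate `α₁ = α log T` of Lemma 15.1 (p. 86, tex L4273–4276:
«`+ O(α₁τ₂(n₁))`»; `α𝓛` is stronger than print by `log T/𝓛 = 𝓛^{0.1}`). This file supplies two of the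
three inputs of the u024/u026-steps at the parameter and at the rate `α₁`, re-running the tree's proofs
(zl-w16-p3's `Section17U023Chi`, `Section17Step17u025`) with `frake 1 ↦ frakeE e1pp 1` and `α𝓛 ↦ α₁` —
both constant-agnostic (they use `‖frakeE e1pp 1‖` only as a number); the third, the summed error of u024
at rate `α₁`, is zl-libA-p1's `Phi3Eval.step17_hE_alpha1_holds` (`Section17SummedErrorAlpha1`):

* `step17_u023ChiRE_of_lemma151ChiRE (e1pp)` — u023-χ at rate `α₁`: for `1 ≤ l₁ < D⁴`,
  `‖Σ'_{(m₁,𝔮)=1} b(l₁m₁)χ(l₁m₁)κ̄₂(m₁)/m₁ − 𝔢₁[e1pp]χ(l₁)τ₂(l₁)‖ ≤ C·α₁·τ₂(l₁)`, from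
  `Lemma151ChiRE e1pp c′` (HYPOTHESIS BY NAME; App. B cone, WP15) + the weight swap
  `Skeleton.swap17_bound` (`𝓛⁻⁸ = α𝓛/π ≤ α₁/π`);
* `step17_hW_core` — the `𝔢`-FREE core of §17.u025's first equality:
  `‖Σ_{l<D⁴}(ν(l)/l)Σ_{l=l₁l₂}χ(l₁)τ₂(l₁)ν₁*(l₂) − Σ_{l<D⁴}ν(l)²/l‖ ≤ ε` eventually (the body of
  `step17_hW_holds` with the factor `𝔢₁` removed), whence `step17_hWE_holds (e1pp)` and
  **`step17_u025E_holds (e1pp) : Step17_u025E e1pp c′`** — the typed E-twin u025 node BY NAME, for EVERY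
  `e1pp` (second equality: Lemma 17.1, `appBLemma171_holds`); at `e1ppj` this is the tree's
  `step17_u025_holds` (sanity `example`).

Theorems only (no definitions, no named facts); axioms standard. WHAT THIS IS NOT: a proof of Lemma 15.1,
of u021 or of (17.8); any claim about Theorems 1–2 of the source or about Landau–Siegel zeros; nothing
here bears on the cell's verdict on (8.24). Companion: `Section17Eq179ChiEdgesE` (the edges u024χ /
u026 / (17.9)ᴿ at the parameter and the leaf assembly `eq17_9RelE_of_chiNodes`).

## References

* Y. Zhang, arXiv:2211.02515v1 (2022), §17 p. 98 (u023–u025); §15 Lemma 15.1 p. 86; §6 p. 28 (`T`,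
  `α₁`); App. B (B.3). [cite: Zhang2022LandauSiegel, §17 u023–u025 p.98]
* R. R. Hall, G. Tenenbaum, *Divisors*, CUP 1988, (0.4). [cite: HallTenenbaum1988, (0.4)]
-/

noncomputable section

open Complex Real Finset ArithmeticFunction
open Literature.NumberTheory.LFunctions.Zhang2022.Skeleton
open Literature.NumberTheory.LFunctions.Zhang2022.Typed.Section17
open Literature.NumberTheory.LFunctions.Zhang2022.MeanSquareMajorant

namespace Literature.NumberTheory.LFunctions.Zhang2022.Phi3Eval

/-! ## §1. u023 in the χ-reading at the parameter `e1pp` and the printed rate `α₁` -/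

section U023E

variable {D : ℕ} (χ : DirichletCharacter ℂ D)

/-- **§17.u023 in the χ-reading, 𝔢₁ := `frakeE e1pp 1`, rate `α₁`** (rows G-L4t6-1/1a, RULING 13d;
RT16-int-1 × RT-05): from Lemma 15.1 in the χ-reading at the parameter and the printed rate
(`Skeleton.Lemma151ChiRE e1pp c′`, hypothesis BY NAME — App. B cone, WP15's deliverable
`Section15EChain.lemma151ChiRE_of_evals`) and the kernel-checked weight swap `Skeleton.swap17_bound`
(`C𝓛⁻⁸τ₂`, `𝓛⁻⁸ = α𝓛/π ≤ α₁/π` by `alpha_mul_ell_le_alpha1`): there is `C` with, for all large `D`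
under (A) and every `1 ≤ l₁ < D⁴`,
`‖Σ'_{(m₁,𝔮)=1} b(l₁m₁)χ(l₁m₁)κ̄₂(m₁)/m₁ − 𝔢₁[e1pp]χ(l₁)τ₂(l₁)‖ ≤ C·α₁·τ₂(l₁)`. The proof is the tree's
`step17_u023Chi_of_lemma151Chi` verbatim with `frake ↦ frakeE e1pp`, `α𝓛 ↦ α₁`.
[cite: Zhang2022LandauSiegel, §17 u023 p.98] -/
theorem step17_u023ChiRE_of_lemma151ChiRE (e1pp : ℕ → ℂ) (c' : ℝ) (h151 : Lemma151ChiRE e1pp c') :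
    ∃ C : ℝ, ForAllLarge fun D _ χ => AssumptionA D χ → ∀ l₁ : ℕ, 1 ≤ l₁ → l₁ < D ^ 4 →
      ‖(∑' m₁ : ℕ, if Nat.Coprime m₁ (frakq D) then
            bcoef D (l₁ * m₁) * χ ((l₁ * m₁ : ℕ) : ZMod D) * kappa2bar c' D m₁ / (m₁ : ℂ) else 0) -
          frakeE e1pp 1 * χ (l₁ : ZMod D) * (l₁.divisors.card : ℂ)‖ ≤
        C * alpha1 D * l₁.divisors.card := by
  obtain ⟨C₁, h₁⟩ := h151
  obtain ⟨C₂, h₂⟩ := swap17_bound c'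
  obtain ⟨D₁, hD₁⟩ := Typed.Sec14.pow_four_le_bigT
  obtain ⟨D₂, hD₂⟩ := exists_nat_forall_le_ell 3
  refine ⟨C₁ + |C₂| / Real.pi, ?_⟩
  obtain ⟨D₀, hall⟩ := h₁.and h₂
  refine ⟨max (max D₀ 3) (max D₁ D₂), fun D _ χ hD hq hp hA l₁ hl1 hl4 => ?_⟩
  have hD0 : D₀ ≤ D := le_trans (le_trans (le_max_left _ _) (le_max_left _ _)) hD
  have hD3 : 3 ≤ D := le_trans (le_trans (le_max_right _ _) (le_max_left _ _)) hD
  have hT := hD₁ D (le_trans (le_trans (le_max_left _ _) (le_max_right _ _)) hD)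
  have hℓ3 := hD₂ D (le_trans (le_trans (le_max_right _ _) (le_max_right _ _)) hD)
  obtain ⟨e151, esw⟩ := hall D χ hD0 hq hp
  have hℓ0 : 0 < ell D := by linarith
  have hπ := Real.pi_pos
  have hα0 : 0 < alpha D := alpha_pos' hℓ0
  have hα : alpha D = Real.pi / ell D ^ 9 := by rw [alpha, bigP, Real.log_exp]
  have hℓ8 : (ell D ^ 8)⁻¹ = alpha D * ell D / Real.pi := by
    rw [hα]; field_simp
  have hα1 : alpha D * ell D ≤ alpha1 D := alpha_mul_ell_le_alpha1 hD3
  have hα10 : 0 ≤ alpha1 D := le_trans (mul_pos hα0 hℓ0).le hα1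
  -- Lemma 15.1 (χ, rate α₁, 𝔢 at the parameter) at `j = 1`, `n₁ = l₁`
  have hmem : l₁ ∈ nset (frakq D) := mem_nset_frakq_of_lt hl1 hl4
  have hlT : (l₁ : ℝ) < bigT D := lt_of_lt_of_le (by exact_mod_cast hl4) hT
  have e1 := e151 hA 1 (by simp) l₁ hmem hlT
  have e2 := esw hA l₁ hl1
  set S := (Finset.Ico 1 ⌈bigP D⌉₊).filter (fun m => Nat.Coprime m (frakq D)) with hS
  rw [tsum_u023Chi_eq_sum χ c' hℓ3 hl1]
  -- split: (ours − Lemma 15.1's sum) + (Lemma 15.1's sum − main)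
  set A : ℂ := ∑ m ∈ S, bcoef D (l₁ * m) * χ ((l₁ * m : ℕ) : ZMod D) * kappa2bar c' D m / (m : ℂ)
    with hAdef
  set B : ℂ := ∑ m ∈ S, χ ((l₁ * m : ℕ) : ZMod D) * bcoef D (l₁ * m) * χ (m : ZMod D) *
    varrhoStar c' χ 1 m / (m : ℂ) with hBdef
  have hAB : A - B = χ (l₁ : ZMod D) * ∑ m ∈ S, bcoef D (l₁ * m) *
      (χ (m : ZMod D) * kappa2bar c' D m - χ (m : ZMod D) ^ 2 * varrhoStar c' χ 1 m) / (m : ℂ) := by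
    rw [hAdef, hBdef, ← Finset.sum_sub_distrib, Finset.mul_sum]
    refine Finset.sum_congr rfl fun m _ => ?_
    push_cast
    rw [map_mul]
    ring
  have hAB' : ‖A - B‖ ≤ C₂ * (ell D ^ 8)⁻¹ * l₁.divisors.card := by
    rw [hAB, norm_mul]
    calc ‖χ (l₁ : ZMod D)‖ * ‖∑ m ∈ S, bcoef D (l₁ * m) *
          (χ (m : ZMod D) * kappa2bar c' D m - χ (m : ZMod D) ^ 2 * varrhoStar c' χ 1 m) / (m : ℂ)‖
        ≤ 1 * ∑ m ∈ S, ‖bcoef D (l₁ * m)‖ *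
            ‖χ (m : ZMod D) * kappa2bar c' D m - varrhoStar c' χ 1 m‖ / (m : ℝ) := by
          refine mul_le_mul (χ.norm_le_one _) ((norm_sum_le _ _).trans (Finset.sum_le_sum
            fun m _ => ?_)) (norm_nonneg _) zero_le_one
          rw [norm_div, norm_mul, Complex.norm_natCast]
          exact div_le_div_of_nonneg_right (mul_le_mul_of_nonneg_left
            (norm_chi_mul_sub_chi_sq_mul_le χ hq m _ _) (norm_nonneg _)) (Nat.cast_nonneg m)
      _ ≤ C₂ * (ell D ^ 8)⁻¹ * l₁.divisors.card := by rw [one_mul]; exact e2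
  have hBmain : ‖B - frakeE e1pp 1 * χ (l₁ : ZMod D) * (l₁.divisors.card : ℂ)‖ ≤
      C₁ * alpha1 D * l₁.divisors.card := by
    have e : frakeE e1pp 1 * χ (l₁ : ZMod D) * (l₁.divisors.card : ℂ) =
        χ (l₁ : ZMod D) * (l₁.divisors.card : ℂ) * frakeE e1pp 1 := by ring
    rw [e]; exact e1
  have hτ0 : (0 : ℝ) ≤ l₁.divisors.card := Nat.cast_nonneg _
  calc ‖A - frakeE e1pp 1 * χ (l₁ : ZMod D) * (l₁.divisors.card : ℂ)‖
      = ‖(A - B) + (B - frakeE e1pp 1 * χ (l₁ : ZMod D) * (l₁.divisors.card : ℂ))‖ := by ring_nf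
    _ ≤ ‖A - B‖ + ‖B - frakeE e1pp 1 * χ (l₁ : ZMod D) * (l₁.divisors.card : ℂ)‖ := norm_add_le _ _
    _ ≤ C₂ * (ell D ^ 8)⁻¹ * l₁.divisors.card + C₁ * alpha1 D * l₁.divisors.card :=
        add_le_add hAB' hBmain
    _ ≤ |C₂| * (ell D ^ 8)⁻¹ * l₁.divisors.card + C₁ * alpha1 D * l₁.divisors.card := by
        gcongr; exact le_abs_self _
    _ = |C₂| / Real.pi * (alpha D * ell D) * l₁.divisors.card + C₁ * alpha1 D * l₁.divisors.card := by
        rw [hℓ8]; field_simp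
    _ ≤ |C₂| / Real.pi * alpha1 D * l₁.divisors.card + C₁ * alpha1 D * l₁.divisors.card := by
        gcongr
    _ = (C₁ + |C₂| / Real.pi) * alpha1 D * l₁.divisors.card := by ring

end U023E

/-! ## §2. §17.u025 at the parameter: the `𝔢`-free core of `hW`, and the node `Step17_u025E e1pp` -/

section U025E

/-- **The `𝔢`-free core of the first equality of §17.u025** (the tree's `step17_hW_holds`,
`Section17Step17u025`, with the factor `𝔢₁` removed; no input on `𝔞`, no use of (A)): for every `c′` and
`ε > 0`, for all large `D`,
`‖Σ_{l<D⁴}(ν(l)/l)Σ_{l=l₁l₂}χ(l₁)τ₂(l₁)ν₁*(l₂) − Σ_{l<D⁴}ν(l)²/l‖ ≤ ε` — indeed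
`≤ (42π·4⁴M + 441π²·4⁸M′)𝓛⁻⁴` (inner sum `= ν + χ∗η₂ + χ∗η₃ + χ∗μ∗η₂∗η₃` exactly, `|η_j| ≤ 21α𝓛`,
Hall–Tenenbaum counts). [cite: Zhang2022LandauSiegel, §17 u025 p.98] -/
theorem step17_hW_core (c' : ℝ) : ∀ ε : ℝ, 0 < ε → ForAllLarge fun D _ χ => AssumptionA D χ →
      ‖(∑ l ∈ Finset.Ico 1 (D ^ 4), nu χ l / (l : ℂ) *
          ∑ q ∈ l.divisorsAntidiagonal,
            χ (q.1 : ZMod D) * (q.1.divisors.card : ℂ) * nuOneStar c' χ q.2) -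
        ∑ l ∈ Finset.Ico 1 (D ^ 4), nu χ l ^ 2 / (l : ℂ)‖ ≤ ε := by
  intro ε hε
  set K : ℝ := 42 * Real.pi * 4 ^ 4 * majorantConst 4 4 + 441 * Real.pi ^ 2 * 4 ^ 8 * majorantConst 8 6
    with hK
  obtain ⟨D₀, hD₀⟩ := hE_thresholds c' K ε hε
  refine ⟨D₀, fun D _ χ hD hq _ _ => ?_⟩
  obtain ⟨hℓ3, hc, hT, hsmall, hKε⟩ := hD₀ D hD
  have hℓ1 : 1 ≤ ell D := by linarith
  have hℓ0 : 0 < ell D := by linarith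
  have hπ := Real.pi_pos
  have hα0 : 0 < alpha D := alpha_pos' hℓ0
  have hα : alpha D = Real.pi / ell D ^ 9 := by rw [alpha, bigP, Real.log_exp]
  have hαℓ : alpha D * ell D = Real.pi / ell D ^ 8 := by rw [hα]; field_simp
  -- `δ = 21α𝓛`
  set δ : ℝ := 21 * (alpha D * ell D) with hδ
  have hδ0 : 0 ≤ δ := by positivity
  have hβ2 : ‖beta2 c' D‖ ≤ 5 * alpha D :=
    (ResidueValues.norm_beta2_le c' hℓ3 hc).trans (by linarith)
  have hβ3 : ‖beta3 c' D‖ ≤ 5 * alpha D :=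
    (ResidueValues.norm_beta3_le c' hℓ3 hc).trans (by linarith)
  have hβ2re : (beta2 c' D).re = 0 := by simp [beta2]
  have hβ3re : (beta3 c' D).re = 0 := by simp [beta3]
  have hη₂ : ∀ n : ℕ, n ≠ 0 → n ≤ D ^ 4 → ‖nN D (beta2 c' D) n - 1‖ ≤ δ := fun n hn hnD =>
    norm_nN_sub_one_le hℓ1 hT hsmall hβ2re hβ2 hn hnD
  have hη₃ : ∀ n : ℕ, n ≠ 0 → n ≤ D ^ 4 → ‖nN D (beta3 c' D) n - 1‖ ≤ δ := fun n hn hnD =>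
    norm_nN_sub_one_le hℓ1 hT hsmall hβ3re hβ3 hn hnD
  -- `D ≥ 2`, `log D⁴ = 4𝓛`
  have hD2 : 2 ≤ D := by
    by_contra h
    have hD1 : (D : ℝ) ≤ 1 := by exact_mod_cast (by omega : D ≤ 1)
    have : ell D ≤ 0 := Real.log_nonpos (Nat.cast_nonneg D) hD1
    linarith
  have hX2 : 2 ≤ D ^ 4 := le_trans hD2 (Nat.le_self_pow (by norm_num) D)
  have hlogX : Real.log ((D ^ 4 : ℕ) : ℝ) = 4 * ell D := by
    push_cast; rw [Real.log_pow]; push_cast; rfl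
  -- abbreviations
  set G₁ : ℕ → ℝ := fun l => ((normAF ((ArithmeticFunction.zeta : ArithmeticFunction ℂ) *
        toArithmeticFunction (fun n : ℕ => χ (n : ZMod D)))).pmul (tau 2)) l with hG₁
  set G₂ : ℕ → ℝ := fun l => ((normAF ((ArithmeticFunction.zeta : ArithmeticFunction ℂ) *
        toArithmeticFunction (fun n : ℕ => χ (n : ZMod D)))).pmul (tau 4)) l with hG₂
  have hG₁0 : ∀ l, 0 ≤ G₁ l := fun l => (isBlock_pmul (isBlock_normAF_nu χ) (isBlock_tau 2)).nonneg l
  have hG₂0 : ∀ l, 0 ≤ G₂ l := fun l => (isBlock_pmul (isBlock_normAF_nu χ) (isBlock_tau 4)).nonneg l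
  have hG₁e : ∀ l, G₁ l = ‖nu χ l‖ * tau 2 l := fun l => by
    simp only [hG₁, pmul_apply, normAF_apply, nuAF_apply]
  have hG₂e : ∀ l, G₂ l = ‖nu χ l‖ * tau 4 l := fun l => by
    simp only [hG₂, pmul_apply, normAF_apply, nuAF_apply]
  -- the inner sums, pointwise
  set W : ℕ → ℂ := fun l => ∑ q ∈ l.divisorsAntidiagonal,
    χ (q.1 : ZMod D) * (q.1.divisors.card : ℂ) * nuOneStar c' χ q.2 with hW
  have hR : ∀ l ∈ Finset.Ico 1 (D ^ 4), ‖W l - nu χ l‖ ≤ 2 * δ * tau 2 l + δ ^ 2 * tau 4 l := by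
    intro l hl
    have hl4 : l ≤ D ^ 4 := (Finset.mem_Ico.1 hl).2.le
    have h₂' : ∀ n : ℕ, n ≠ 0 → n ≤ l → ‖nN D (beta2 c' D) n - 1‖ ≤ δ := fun n hn hnl =>
      hη₂ n hn (hnl.trans hl4)
    have h₃' : ∀ n : ℕ, n ≠ 0 → n ≤ l → ‖nN D (beta3 c' D) n - 1‖ ≤ δ := fun n hn hnl =>
      hη₃ n hn (hnl.trans hl4)
    rw [hW]
    simp only
    rw [inner17_u025_eq c' χ hl4]
    have e : nu χ l +
        (toArithmeticFunction (fun k : ℕ => χ (k : ZMod D)) *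
          toArithmeticFunction (fun n : ℕ => nN D (beta2 c' D) n - 1)) l +
        (toArithmeticFunction (fun k : ℕ => χ (k : ZMod D)) *
          toArithmeticFunction (fun n : ℕ => nN D (beta3 c' D) n - 1)) l +
        (toArithmeticFunction (fun k : ℕ => χ (k : ZMod D)) *
          (ArithmeticFunction.moebius : ArithmeticFunction ℂ) *
          toArithmeticFunction (fun n : ℕ => nN D (beta2 c' D) n - 1) *
          toArithmeticFunction (fun n : ℕ => nN D (beta3 c' D) n - 1)) l - nu χ l =
        (toArithmeticFunction (fun k : ℕ => χ (k : ZMod D)) *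
          toArithmeticFunction (fun n : ℕ => nN D (beta2 c' D) n - 1)) l +
        (toArithmeticFunction (fun k : ℕ => χ (k : ZMod D)) *
          toArithmeticFunction (fun n : ℕ => nN D (beta3 c' D) n - 1)) l +
        (toArithmeticFunction (fun k : ℕ => χ (k : ZMod D)) *
          (ArithmeticFunction.moebius : ArithmeticFunction ℂ) *
          toArithmeticFunction (fun n : ℕ => nN D (beta2 c' D) n - 1) *
          toArithmeticFunction (fun n : ℕ => nN D (beta3 c' D) n - 1)) l := by ring
    rw [e]
    calc _ ≤ ‖(toArithmeticFunction (fun k : ℕ => χ (k : ZMod D)) *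
            toArithmeticFunction (fun n : ℕ => nN D (beta2 c' D) n - 1)) l‖ +
          ‖(toArithmeticFunction (fun k : ℕ => χ (k : ZMod D)) *
            toArithmeticFunction (fun n : ℕ => nN D (beta3 c' D) n - 1)) l‖ +
          ‖(toArithmeticFunction (fun k : ℕ => χ (k : ZMod D)) *
            (ArithmeticFunction.moebius : ArithmeticFunction ℂ) *
            toArithmeticFunction (fun n : ℕ => nN D (beta2 c' D) n - 1) *
            toArithmeticFunction (fun n : ℕ => nN D (beta3 c' D) n - 1)) l‖ :=
          (norm_add_le _ _).trans (add_le_add (norm_add_le _ _) le_rfl)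
      _ ≤ δ * tau 2 l + δ * tau 2 l + δ ^ 2 * tau 4 l :=
          add_le_add (add_le_add (norm_chiAF_mul_toAF_apply_le χ h₂')
            (norm_chiAF_mul_toAF_apply_le χ h₃')) (norm_chi_moebius_mul_mul_apply_le χ hδ0 h₂' h₃')
      _ = 2 * δ * tau 2 l + δ ^ 2 * tau 4 l := by ring
  -- the difference as `𝔢₁·Σ_l (ν(l)/l)(W(l) − ν(l))`
  have hdiff : (∑ l ∈ Finset.Ico 1 (D ^ 4), nu χ l / (l : ℂ) * W l) -
      ∑ l ∈ Finset.Ico 1 (D ^ 4), nu χ l ^ 2 / (l : ℂ) =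
      ∑ l ∈ Finset.Ico 1 (D ^ 4), nu χ l / (l : ℂ) * (W l - nu χ l) := by
    rw [← Finset.sum_sub_distrib]
    exact Finset.sum_congr rfl fun l _ => by ring
  have hsumR : ∑ l ∈ Finset.Ico 1 (D ^ 4), ‖nu χ l‖ / l * (2 * δ * tau 2 l + δ ^ 2 * tau 4 l) ≤
      2 * δ * (majorantConst 4 4 * (4 * ell D) ^ 4) + δ ^ 2 * (majorantConst 8 6 * (4 * ell D) ^ 8) := by
    have h1 := sum_normNu_tau_two_div_le χ hq hX2
    have h2 := sum_normNu_tau_four_div_le χ hq hX2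
    rw [hlogX] at h1 h2
    calc ∑ l ∈ Finset.Ico 1 (D ^ 4), ‖nu χ l‖ / l * (2 * δ * tau 2 l + δ ^ 2 * tau 4 l)
        = ∑ l ∈ Finset.Ico 1 (D ^ 4), (2 * δ * (G₁ l / l) + δ ^ 2 * (G₂ l / l)) :=
          Finset.sum_congr rfl fun l _ => by rw [hG₁e, hG₂e]; ring
      _ ≤ ∑ l ∈ Finset.Icc 1 (D ^ 4), (2 * δ * (G₁ l / l) + δ ^ 2 * (G₂ l / l)) :=
          Finset.sum_le_sum_of_subset_of_nonneg Finset.Ico_subset_Icc_self fun l _ _ =>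
            add_nonneg (mul_nonneg (by positivity) (div_nonneg (hG₁0 l) (Nat.cast_nonneg l)))
              (mul_nonneg (by positivity) (div_nonneg (hG₂0 l) (Nat.cast_nonneg l)))
      _ = 2 * δ * (∑ l ∈ Finset.Icc 1 (D ^ 4), G₁ l / l) +
            δ ^ 2 * ∑ l ∈ Finset.Icc 1 (D ^ 4), G₂ l / l := by
          rw [Finset.sum_add_distrib, Finset.mul_sum, Finset.mul_sum]
      _ ≤ 2 * δ * (majorantConst 4 4 * (4 * ell D) ^ 4) + δ ^ 2 * (majorantConst 8 6 * (4 * ell D) ^ 8) :=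
          add_le_add (mul_le_mul_of_nonneg_left h1 (by positivity))
            (mul_le_mul_of_nonneg_left h2 (by positivity))  -- assemble
  change ‖(∑ l ∈ Finset.Ico 1 (D ^ 4), nu χ l / (l : ℂ) * W l) -
      ∑ l ∈ Finset.Ico 1 (D ^ 4), nu χ l ^ 2 / (l : ℂ)‖ ≤ ε
  rw [hdiff]
  have hS : ‖∑ l ∈ Finset.Ico 1 (D ^ 4), nu χ l / (l : ℂ) * (W l - nu χ l)‖ ≤
      2 * δ * (majorantConst 4 4 * (4 * ell D) ^ 4) + δ ^ 2 * (majorantConst 8 6 * (4 * ell D) ^ 8) := by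
    refine (norm_sum_le _ _).trans (le_trans (Finset.sum_le_sum fun l hl => ?_) hsumR)
    rw [norm_mul, norm_div, Complex.norm_natCast]
    exact mul_le_mul_of_nonneg_left (hR l hl) (div_nonneg (norm_nonneg _) (Nat.cast_nonneg l))
  have hℓ48 : (ell D ^ 8)⁻¹ ≤ (ell D ^ 4)⁻¹ :=
    inv_anti₀ (by positivity) (pow_le_pow_right₀ hℓ1 (by norm_num))
  calc ‖∑ l ∈ Finset.Ico 1 (D ^ 4), nu χ l / (l : ℂ) * (W l - nu χ l)‖
      ≤ 2 * δ * (majorantConst 4 4 * (4 * ell D) ^ 4) +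
          δ ^ 2 * (majorantConst 8 6 * (4 * ell D) ^ 8) := hS
    _ = 42 * Real.pi * 4 ^ 4 * majorantConst 4 4 * (ell D ^ 4)⁻¹ +
          441 * Real.pi ^ 2 * 4 ^ 8 * majorantConst 8 6 * (ell D ^ 8)⁻¹ := by
        rw [hδ, hαℓ]
        field_simp
        ring
    _ ≤ 42 * Real.pi * 4 ^ 4 * majorantConst 4 4 * (ell D ^ 4)⁻¹ +
          441 * Real.pi ^ 2 * 4 ^ 8 * majorantConst 8 6 * (ell D ^ 4)⁻¹ := by
        have hM : 0 ≤ 441 * Real.pi ^ 2 * 4 ^ 8 * majorantConst 8 6 :=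
          mul_nonneg (by positivity) (majorantConst_pos 8 6).le
        gcongr
    _ = K / ell D ^ 4 := by rw [hK]; field_simp
    _ ≤ ε := hKε

/-- **The first equality of §17.u025 at the parameter `e″ = e1pp`** (hypothesis `hW` with
`𝔢₁ := frakeE e1pp 1`): `‖𝔢₁[e1pp]·Σ_{l<D⁴}(ν(l)/l)Σ_{l=l₁l₂}χ(l₁)τ₂(l₁)ν₁*(l₂) − 𝔢₁[e1pp]·Σ_{l<D⁴}ν(l)²/l‖
≤ ε` eventually, for EVERY `e1pp` — `step17_hW_core` times the number `‖frakeE e1pp 1‖`.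
[cite: Zhang2022LandauSiegel, §17 u025 p.98] -/
theorem step17_hWE_holds (e1pp : ℕ → ℂ) (c' : ℝ) :
    ∀ ε : ℝ, 0 < ε → ForAllLarge fun D _ χ => AssumptionA D χ →
      ‖frakeE e1pp 1 * (∑ l ∈ Finset.Ico 1 (D ^ 4), nu χ l / (l : ℂ) *
          ∑ q ∈ l.divisorsAntidiagonal,
            χ (q.1 : ZMod D) * (q.1.divisors.card : ℂ) * nuOneStar c' χ q.2) -
        frakeE e1pp 1 * ∑ l ∈ Finset.Ico 1 (D ^ 4), nu χ l ^ 2 / (l : ℂ)‖ ≤ ε := by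
  intro ε hε
  have hε' : 0 < ε / (‖frakeE e1pp 1‖ + 1) := by positivity
  refine (step17_hW_core c' _ hε').mono fun D _ χ _ _ h hA => ?_
  have e := h hA
  rw [← mul_sub, norm_mul]
  have h0 : 0 ≤ ‖frakeE e1pp 1‖ := norm_nonneg _
  calc ‖frakeE e1pp 1‖ * ‖(∑ l ∈ Finset.Ico 1 (D ^ 4), nu χ l / (l : ℂ) *
          ∑ q ∈ l.divisorsAntidiagonal,
            χ (q.1 : ZMod D) * (q.1.divisors.card : ℂ) * nuOneStar c' χ q.2) -
        ∑ l ∈ Finset.Ico 1 (D ^ 4), nu χ l ^ 2 / (l : ℂ)‖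
      ≤ ‖frakeE e1pp 1‖ * (ε / (‖frakeE e1pp 1‖ + 1)) := mul_le_mul_of_nonneg_left e h0
    _ ≤ ε := by
        rw [mul_div_assoc', div_le_iff₀ (by positivity)]
        nlinarith

/-- **§17.u025 at the parameter is a THEOREM for every `e1pp`**: the typed E-twin node
`Typed.Section17.Step17_u025E e1pp c′` BY NAME ("the right side [of u024] is equal to
`𝔢₁Σ_{l<D⁴}ν(l)²/l + o(1) = 𝔢₁𝔞 + o(1)`" with `𝔢₁ := frakeE e1pp 1`) — the first equality by
`step17_hWE_holds`, the second by Lemma 17.1 (`appBLemma171_holds`) times `‖frakeE e1pp 1‖`; the proof is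
the tree's `step17_u025_of` verbatim at the parameter. Instance `e1ppj` = the tree's `step17_u025_holds`
(`Step17_u025E e1ppj = Step17_u025`, `rfl`). [cite: Zhang2022LandauSiegel, §17 u025 p.98] -/
theorem step17_u025E_holds (e1pp : ℕ → ℂ) (c' : ℝ) : Step17_u025E e1pp c' := by
  intro ε hε
  obtain ⟨C, D₀, hC⟩ := appBLemma171_holds
  obtain ⟨D₁, h1⟩ := step17_hWE_holds e1pp c' ε hε
  obtain ⟨D₂, h2⟩ := exists_nat_forall_le_ell (max 1 (‖frakeE e1pp 1‖ * |C| / ε))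
  refine ⟨max (max D₀ D₁) D₂, fun D _ χ hD hq hp hA => ?_⟩
  have hD0 : D₀ ≤ D := le_trans (le_trans (le_max_left _ _) (le_max_left _ _)) hD
  have hD1 : D₁ ≤ D := le_trans (le_trans (le_max_right _ _) (le_max_left _ _)) hD
  have hℓ := h2 D (le_trans (le_max_right _ _) hD)
  have hℓ1 : 1 ≤ ell D := le_trans (le_max_left _ _) hℓ
  have hℓC : ‖frakeE e1pp 1‖ * |C| / ε ≤ ell D := le_trans (le_max_right _ _) hℓ
  refine ⟨h1 D χ hD1 hq hp hA, ?_⟩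
  have key := hC D χ hD0 hq hp hA
  rw [← mul_sub, norm_mul, sum_Ico_nu_sq_eq_ofReal_range χ hq.sq_eq_one, ← Complex.ofReal_sub,
    Complex.norm_real, Real.norm_eq_abs]
  have hℓpow : ell D ≤ ell D ^ 2011 := by
    calc ell D = ell D ^ 1 := (pow_one _).symm
      _ ≤ ell D ^ 2011 := pow_le_pow_right₀ hℓ1 (by norm_num)
  have hℓ0 : 0 < ell D := by linarith
  have hS : |∑ n ∈ Finset.range (D ^ 4), ‖nu χ n‖ ^ 2 / (n : ℝ) - frakA χ| ≤ |C| / ell D :=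
    key.trans ((div_le_div_of_nonneg_right (le_abs_self C) (by positivity)).trans
      (div_le_div_of_nonneg_left (abs_nonneg C) hℓ0 hℓpow))
  calc ‖frakeE e1pp 1‖ * |∑ n ∈ Finset.range (D ^ 4), ‖nu χ n‖ ^ 2 / (n : ℝ) - frakA χ|
      ≤ ‖frakeE e1pp 1‖ * (|C| / ell D) := mul_le_mul_of_nonneg_left hS (norm_nonneg _)
    _ = ‖frakeE e1pp 1‖ * |C| / ε * ε / ell D := by field_simp
    _ ≤ ell D * ε / ell D := by gcongr
    _ = ε := by field_simp

/-- Sanity (RT-05 C1/C2): at the stated `e″ = e1ppj`, `step17_u025E_holds` is the tree's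
`step17_u025_holds` (`Step17_u025E e1ppj c′ = Step17_u025 c′` by `rfl`).
[cite: Zhang2022LandauSiegel, §17 u025 p.98] -/
example (c' : ℝ) : Step17_u025 c' := step17_u025E_holds e1ppj c'

end U025E

end Literature.NumberTheory.LFunctions.Zhang2022.Phi3Eval
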